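import Literature.Algebra.EuclideanLattices.IntegerBallBudgetRegion
import Mathlib.Algebra.BigOperators.Ring.Finset
import Mathlib.Algebra.Order.Group.Int
import Mathlib.Data.Int.Interval
import Mathlib.Order.Interval.Finset.Nat
import HarnessLib

/-!
# The rounded-budget region: grouped dynamic programme and the size of a coordinate fibre

Sequel of `IntegerBallBudgetRegion.lean` (everything PROVED; no named fact). The dynamic programme
`BudgetRegion.count U (k+1) q = ∑_{z² ≤ qU} count U k (q − ⌊z²/U⌋)` has exponentially many terms
(`2⌊√(qU)⌋ + 1` values of `z`), but only `q + 1` distinct ones: grouping the coordinate values by the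
cost `j = ⌊z²/U⌋` they incur,

  `count U (k+1) q = ∑_{j ≤ q} #fiber(q, j) · count U k (q − j)`     (`count_succ_eq_sum_fiber`),

where `fiber U q j = {z : z² ≤ qU, ⌊z²/U⌋ = j}` (`BudgetRegion.fiber`), and each fibre is the union
of two mirror-image integer intervals whose ends are integer square roots:

  `#fiber(q, j) = 2 · (min(⌊√(qU)⌋, ⌊√((j+1)U − 1)⌋) + 1 − max(1, lo j))⁺ + [j = 0]`,
  `lo 0 = 0`, `lo j = ⌊√(jU − 1)⌋ + 1 (j ≥ 1)`                          (`length_fiber`, `U ≥ 1`).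

So `count` (and the cumulative counts that `unrank`/`rank` consume) are computable with
`poly(n, q, log U)` arithmetic operations — the form needed by any polynomial-time (or reversible)
implementation; this file only proves the two identities.

## References

* M. Dyer, *Approximate counting by dynamic programming*, Proc. 35th STOC (2003) 693–699
  (the rounding/DP paradigm) [Dyer2003].
* A. Nijenhuis, H. S. Wilf, *Combinatorial Algorithms*, 2nd ed., Academic Press 1978, Ch. 13.
-/

namespace Literature.Algebra.EuclideanLattices

namespace BudgetRegion

open Finset

variable (U : ℕ)

/-! ## Grouping the dynamic programme by the cost of a coordinate -/

/-- The fibre of cost `j` under budget `q`: the candidate values `z` (`z² ≤ qU`) with `⌊z²/U⌋ = j`,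
as a sublist of `coordVals U q`. [folklore] -/
def fiber (q j : ℕ) : List ℤ := (coordVals U q).filter fun z => sq z / U = j

/-- Membership in a fibre. [folklore] -/
theorem mem_fiber {q j : ℕ} {z : ℤ} : z ∈ fiber U q j ↔ sq z ≤ q * U ∧ sq z / U = j := by
  simp [fiber, List.mem_filter, mem_coordVals]

/-- A generic regrouping: summing `h (key a)` over a list is summing `#{a : key a = j} · h j` over
the possible keys `j ≤ q`. [folklore] -/
theorem sum_map_eq_sum_range_length_filter_mul {α : Type*} (l : List α) (key : α → ℕ) (h : ℕ → ℕ)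
    {q : ℕ} (hkey : ∀ a ∈ l, key a ≤ q) :
    (l.map fun a => h (key a)).sum =
      ∑ j ∈ range (q + 1), (l.filter fun a => key a = j).length * h j := by
  induction l with
  | nil => simp
  | cons a l ih =>
      have ha : key a < q + 1 := Nat.lt_succ_of_le (hkey a (by simp))
      have hl : ∀ b ∈ l, key b ≤ q := fun b hb => hkey b (by simp [hb])
      rw [List.map_cons, List.sum_cons, ih hl]
      have hsplit : ∀ j ∈ range (q + 1),
          ((a :: l).filter fun b => key b = j).length * h j =
            (if key a = j then h j else 0) + (l.filter fun b => key b = j).length * h j := by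
        intro j _
        by_cases hj : key a = j
        · have e : (a :: l).filter (fun b => key b = j) = a :: l.filter (fun b => key b = j) := by
            simp [hj]
          rw [e, List.length_cons, if_pos hj]; ring
        · have e : (a :: l).filter (fun b => key b = j) = l.filter (fun b => key b = j) := by
            simp [hj]
          rw [e, if_neg hj, zero_add]
      rw [sum_congr rfl hsplit, sum_add_distrib, sum_ite_eq (range (q + 1)) (key a) h, if_pos (by simpa using ha)]

/-- **The grouped dynamic programme**: `count U (k+1) q = ∑_{j ≤ q} #fiber(q, j) · count U k (q − j)`.
[folklore] -/
theorem count_succ_eq_sum_fiber (hU : 0 < U) (k q : ℕ) :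
    count U (k + 1) q = ∑ j ∈ range (q + 1), (fiber U q j).length * count U k (q - j) := by
  rw [count_succ]
  have hkey : ∀ z ∈ coordVals U q, sq z / U ≤ q := fun z hz => by
    rw [mem_coordVals] at hz
    calc sq z / U ≤ q * U / U := Nat.div_le_div_right hz
      _ = q := Nat.mul_div_cancel q hU
  exact sum_map_eq_sum_range_length_filter_mul (coordVals U q) (fun z => sq z / U)
    (fun j => count U k (q - j)) hkey

/-! ## The size of a fibre -/

/-- `⌊a/U⌋ = j ↔ jU ≤ a < (j+1)U` (`U > 0`). [folklore] -/
theorem div_eq_iff_mem_Ico (hU : 0 < U) {a j : ℕ} : a / U = j ↔ j * U ≤ a ∧ a < (j + 1) * U := by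
  constructor
  · rintro rfl
    refine ⟨Nat.div_mul_le_self a U, ?_⟩
    have := Nat.lt_div_mul_add (a := a) hU
    rw [Nat.succ_mul]
    exact this
  · rintro ⟨h1, h2⟩
    apply le_antisymm
    · exact Nat.lt_succ_iff.1 ((Nat.div_lt_iff_lt_mul hU).2 h2)
    · exact (Nat.le_div_iff_mul_le hU).2 h1

/-- The lower end of the fibre of cost `j` on the natural numbers: the least `m` with `jU ≤ m²`,
i.e. `0` for `j = 0` and `⌊√(jU − 1)⌋ + 1` for `j ≥ 1`. [folklore] -/
def lo (j : ℕ) : ℕ := if j = 0 then 0 else Nat.sqrt (j * U - 1) + 1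

/-- `jU ≤ m² ↔ lo j ≤ m` (`U > 0`). [folklore] -/
theorem le_sq_iff_lo_le (hU : 0 < U) {j m : ℕ} : j * U ≤ m ^ 2 ↔ lo U j ≤ m := by
  unfold lo
  split_ifs with hj
  · simp [hj]
  · have hjU : 1 ≤ j * U := Nat.one_le_iff_ne_zero.2 (Nat.mul_ne_zero hj hU.ne')
    rw [Nat.succ_le_iff, ← not_le, Nat.le_sqrt']
    omega

/-- `m² < (j+1)U ↔ m ≤ ⌊√((j+1)U − 1)⌋` (`U > 0`). [folklore] -/
theorem sq_lt_iff_le_sqrt (hU : 0 < U) {j m : ℕ} :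
    m ^ 2 < (j + 1) * U ↔ m ≤ Nat.sqrt ((j + 1) * U - 1) := by
  have h1 : 1 ≤ (j + 1) * U := Nat.one_le_iff_ne_zero.2 (Nat.mul_ne_zero (Nat.succ_ne_zero j) hU.ne')
  rw [Nat.le_sqrt']
  omega

/-- **The positive half of a fibre is an interval of integer square roots**: for `U > 0`,
`{m ∈ [1, ⌊√(qU)⌋] : ⌊m²/U⌋ = j} = [max(1, lo j), min(⌊√(qU)⌋, ⌊√((j+1)U − 1)⌋)]`. [folklore] -/
theorem filter_Icc_eq (hU : 0 < U) (q j : ℕ) :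
    (Icc 1 (Nat.sqrt (q * U))).filter (fun m : ℕ => m ^ 2 / U = j) =
      Icc (max 1 (lo U j)) (min (Nat.sqrt (q * U)) (Nat.sqrt ((j + 1) * U - 1))) := by
  ext m
  simp only [mem_filter, mem_Icc, div_eq_iff_mem_Ico U hU, le_sq_iff_lo_le U hU,
    sq_lt_iff_le_sqrt U hU, max_le_iff, le_min_iff]
  tauto

/-- The candidate list has no duplicates. [folklore] -/
theorem nodup_coordVals (q : ℕ) : (coordVals U q).Nodup :=
  (List.nodup_range).map (f := fun t : ℕ => (t : ℤ) - Nat.sqrt (q * U)) fun a b h => by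
    simpa using h

/-- The candidate list enumerates the integer interval `[−s, s]`, `s = ⌊√(qU)⌋`. [folklore] -/
theorem toFinset_coordVals (q : ℕ) :
    (coordVals U q).toFinset = Icc (-(Nat.sqrt (q * U) : ℤ)) (Nat.sqrt (q * U)) := by
  ext z
  rw [List.mem_toFinset, mem_coordVals, mem_Icc, sq, ← Nat.le_sqrt']
  omega

/-- The length of a fibre as the cardinality of a filtered integer interval. [folklore] -/
theorem length_fiber_eq_card (q j : ℕ) :
    (fiber U q j).length =
      ((Icc (-(Nat.sqrt (q * U) : ℤ)) (Nat.sqrt (q * U))).filter fun z => sq z / U = j).card := by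
  rw [fiber, ← List.toFinset_card_of_nodup ((nodup_coordVals U q).filter _), List.toFinset_filter,
    toFinset_coordVals]
  congr 1
  ext z
  simp

/-- Splitting the filtered symmetric interval `[−s, s]` into its negative part (mirror image of the
positive part under `z ↦ −z`, the predicate being even), zero, and its positive part, and passing to
natural numbers. [folklore] -/
theorem card_filter_Icc_symm (s j : ℕ) :
    ((Icc (-(s : ℤ)) s).filter fun z => sq z / U = j).card =
      2 * ((Icc 1 s).filter fun m : ℕ => m ^ 2 / U = j).card + if (0 : ℕ) / U = j then 1 else 0 := by
  classical
  -- the three pieces of `[−s, s]`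
  set P : ℤ → Prop := fun z => sq z / U = j with hP
  have hsplit : Icc (-(s : ℤ)) s = Icc (-(s : ℤ)) (-1) ∪ {0} ∪ Icc 1 (s : ℤ) := by
    ext z; simp only [mem_union, mem_Icc, mem_singleton]; omega
  have hd1 : Disjoint (Icc (-(s : ℤ)) (-1)) ({0} : Finset ℤ) := by
    rw [disjoint_singleton_right, mem_Icc]; omega
  have hd2 : Disjoint (Icc (-(s : ℤ)) (-1) ∪ {0}) (Icc 1 (s : ℤ)) := by
    rw [disjoint_left]; intro z hz hz'
    simp only [mem_union, mem_Icc, mem_singleton] at hz hz'; omega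
  rw [hsplit, filter_union, filter_union, card_union_of_disjoint, card_union_of_disjoint]
  rotate_left
  · exact disjoint_filter_filter hd1
  · rw [← filter_union]; exact disjoint_filter_filter hd2
  -- negative part = positive part (mirror)
  have hneg : ((Icc (-(s : ℤ)) (-1)).filter P).card = ((Icc 1 (s : ℤ)).filter P).card := by
    refine card_bij (fun z _ => -z) (fun z hz => ?_) (fun a _ b _ h => neg_injective h)
      (fun z hz => ⟨-z, ?_, neg_neg z⟩)
    · simp only [mem_filter, mem_Icc, hP, sq, Int.natAbs_neg] at hz ⊢; omega
    · simp only [mem_filter, mem_Icc, hP, sq, Int.natAbs_neg] at hz ⊢; omega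
  -- positive part over `ℕ` = positive part over `ℤ`
  have hpos : ((Icc 1 s).filter fun m : ℕ => m ^ 2 / U = j).card = ((Icc 1 (s : ℤ)).filter P).card := by
    apply card_bij (fun (m : ℕ) _ => (m : ℤ))
    · intro m hm
      simp only [mem_filter, mem_Icc, hP, sq, Int.natAbs_natCast] at hm ⊢
      exact ⟨⟨by exact_mod_cast hm.1.1, by exact_mod_cast hm.1.2⟩, hm.2⟩
    · intro a _ b _ h
      exact_mod_cast h
    · intro z hz
      simp only [mem_filter, mem_Icc, hP, sq] at hz
      refine ⟨z.toNat, ?_, by omega⟩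
      simp only [mem_filter, mem_Icc]
      have h1 : z.toNat = z.natAbs := by omega
      rw [h1]
      exact ⟨⟨by omega, by omega⟩, hz.2⟩
  -- zero
  have hzero : (({0} : Finset ℤ).filter P).card = if (0 : ℕ) / U = j then 1 else 0 := by
    rw [filter_singleton]
    have : P 0 ↔ (0 : ℕ) / U = j := by simp [hP, sq]
    by_cases h : (0 : ℕ) / U = j
    · rw [if_pos (this.2 h), if_pos h, card_singleton]
    · rw [if_neg (fun h' => h (this.1 h')), if_neg h, card_empty]
  rw [hneg, ← hpos, hzero]
  ring

/-- **The size of a fibre in closed form** (`U > 0`): with `s = ⌊√(qU)⌋`,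
`#fiber(q, j) = 2 · (min(s, ⌊√((j+1)U − 1)⌋) + 1 − max(1, lo j)) + [j = 0]` (truncated subtraction).
[folklore] -/
theorem length_fiber (hU : 0 < U) (q j : ℕ) :
    (fiber U q j).length =
      2 * (min (Nat.sqrt (q * U)) (Nat.sqrt ((j + 1) * U - 1)) + 1 - max 1 (lo U j)) +
        if j = 0 then 1 else 0 := by
  rw [length_fiber_eq_card, card_filter_Icc_symm, filter_Icc_eq U hU, Nat.card_Icc, Nat.zero_div]
  by_cases hj : j = 0
  · simp [hj]
  · rw [if_neg (Ne.symm hj), if_neg hj]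

/-- Fibres of cost `j > q` are empty (a candidate value costs at most the budget). [folklore] -/
theorem fiber_eq_nil_of_lt (hU : 0 < U) {q j : ℕ} (hj : q < j) : fiber U q j = [] := by
  rw [fiber, List.filter_eq_nil_iff]
  intro z hz
  rw [mem_coordVals] at hz
  have : sq z / U ≤ q := by
    calc sq z / U ≤ q * U / U := Nat.div_le_div_right hz
      _ = q := Nat.mul_div_cancel q hU
  simp only [decide_eq_true_eq]
  omega

end BudgetRegion

end Literature.Algebra.EuclideanLattices
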